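import Literature.NumberTheory.DiophantineGeometry.TateAlgorithmEvalProofs
import Literature.NumberTheory.DiophantineGeometry.TateAlgorithmIstarCharTwoProofs
import HarnessLib

/-!
# Tate's algorithm for the Mordell equations `y² = x³ + ϖᵃγ` in residue characteristic `2`

`Proofs` file (theorems only, no definitions, no named facts) in topic
`NumberTheory/DiophantineGeometry`, sequel of `TateAlgorithmEvalProofs`, landed by the seat of
bsd.S15 (`Literature.NumberTheory.EllipticCurves.conductorNorm_eq_artinConductorNat`) as the local
half of the discriminant side of Ogg's formula at `2` for the curves of invariant `j = 0` over `ℚ`.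

Over a DVR `R` with uniformiser `ϖ`, perfect residue field and `2 = ϖε` (`ε` a unit; e.g. `ℤ₂`),
for an equation `W` with `a₁ = a₂ = a₃ = a₄ = 0` (`Δ = -432a₆²`, `ord Δ = 2a + 4` when
`a₆ = ϖᵃγ`, `addVal_Δ_toNat_of_mordell`), the literal Tate algorithm
`WeierstrassCurve.kodairaSymbolOfMinimal` returns (Silverman *ATAEC* IV.9.4, Table 4.1):

* `a₆ = 1 + ϖδ`, `δ` a unit (over `ℤ₂`: `k ≡ 3 (mod 4)`): **II** — after `y ↦ y + 1`,
  `(0, 0, 2, 0, ϖδ)`, `π² ∤ a₆` (`kodairaSymbolOfMinimal_mordell_zero_eq_II`);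
* `a₆ = 1 + ϖ²δ` (`k ≡ 1 (mod 4)`): **IV** — `(0, 0, 2, 0, ϖ²δ)`, `b₈ = 0`, `b₆ = 4a₆`, `π³ ∤ b₆`
  (`…_zero_eq_IV`);
* `a₆ = ϖγ` (`2 ∥ k`): **II** (`…_one_eq_II`);
* `a₆ = ϖ²(1 + ϖδ)` (`k = 4u`, `u ≡ 3`): **I₀*** — after `y ↦ y + ϖ`, `(0, 0, 2ϖ, 0, ϖ³δ)`, cubic
  `T³ + δ̄` separable in characteristic `2` (`…_two_eq_Istar_zero`);
* `a₆ = ϖ²(1 + ϖ²δ)` (`k = 4u`, `u ≡ 1`): **IV*** — `(0, 0, 2ϖ, 0, ϖ⁴δ)`, quadratic `Y² + ε̄Y - δ̄`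
  separable (`…_two_eq_IVstar`);
* `a₆ = ϖ³γ` (`8 ∥ k`): **I₀*** (cubic `T³ + γ̄`) (`…_three_eq_Istar_zero`);
* `a₆ = ϖ⁴(1 + ϖδ)` (`k = 16u`, `u ≡ 3`): **II*** — after `y ↦ y + ϖ²`, `(0, 0, 2ϖ², 0, ϖ⁵δ)`
  (`…_four_eq_IIstar`; for `u ≡ 1 (mod 4)` the equation is not minimal);
* `a₆ = ϖ⁵γ` (`32 ∥ k`): **II*** (`…_five_eq_IIstar`).

Each case is the forward-evaluation theorem of `TateAlgorithmEvalProofs` applied to a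
`y`-translate (`mordell_yTranslate`; the output is invariant, `kodairaSymbolOfMinimal_smul`).
Minimality is not needed for these statements (they are about the literal function); over `ℚ₂` it
is supplied in `MordellCurveTateAlgorithmTwoProofs`.

## References

* J. H. Silverman, *Advanced Topics in the Arithmetic of Elliptic Curves*, GTM 151 (1994), IV.9.4
  (Tate's algorithm, PDF pp. 344–346) and Table 4.1. [SilvermanATAEC1994]
* J. Tate, *Algorithm for determining the type of a singular fiber in an elliptic pencil*, LNM 476
  (1975), §§7–8. [Tate1975]
-/

noncomputable section

open Polynomial IsLocalRing
open IsDiscreteValuationRing hiding maximalIdeal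

namespace Literature.NumberTheory.DiophantineGeometry

namespace TateAlgorithm

variable {R : Type*} [CommRing R] [IsDomain R] [IsDiscreteValuationRing R]

/-! ### The Mordell equation `y² = x³ + k` over a DVR of residue characteristic `2` -/

section Mordell

omit [IsDomain R] [IsDiscreteValuationRing R] in
/-- `Δ = -432 a₆²` for `y² = x³ + a₆`. [folklore] -/
theorem Δ_of_mordell {W : WeierstrassCurve R} (h₁ : W.a₁ = 0) (h₂ : W.a₂ = 0) (h₃ : W.a₃ = 0)
    (h₄ : W.a₄ = 0) : W.Δ = -432 * W.a₆ ^ 2 := by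
  simp only [WeierstrassCurve.Δ, WeierstrassCurve.b₂, WeierstrassCurve.b₄, WeierstrassCurve.b₆,
    WeierstrassCurve.b₈, h₁, h₂, h₃, h₄]
  ring

/-- With `2 = ϖε`, `27` is a unit of `R` (`27 = 1 + 2·13`). [folklore] -/
theorem isUnit_27 {ε : R} (hε : (2 : R) = uniformizer R * ε) : IsUnit (27 : R) := by
  have hϖ : Irreducible (uniformizer R) := irreducible_uniformizer
  have h : (27 : R) = 1 + uniformizer R * (ε * 13) := by
    rw [← mul_assoc, ← hε]; norm_num
  rw [h]
  exact isUnit_add_mul_of_isUnit hϖ isUnit_one _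

/-- `ord Δ = 2a + 4` for `y² = x³ + ϖᵃγ` (`γ` a unit, `2 = ϖε`): `Δ = -27·ε⁴·γ²·ϖ^{2a+4}`.
[folklore] -/
theorem addVal_Δ_toNat_of_mordell {W : WeierstrassCurve R} (h₁ : W.a₁ = 0) (h₂ : W.a₂ = 0)
    (h₃ : W.a₃ = 0) (h₄ : W.a₄ = 0) {ε : R} (hε : (2 : R) = uniformizer R * ε) (hεu : IsUnit ε)
    {a : ℕ} {γ : R} (ha₆ : W.a₆ = uniformizer R ^ a * γ) (hγ : IsUnit γ) :
    (addVal R W.Δ).toNat = 2 * a + 4 := by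
  have hϖ : Irreducible (uniformizer R) := irreducible_uniformizer
  have e : 1 * W.Δ = uniformizer R ^ (2 * a + 4) * (-(27 * ε ^ 4 * γ ^ 2)) := by
    rw [one_mul, Δ_of_mordell h₁ h₂ h₃ h₄, ha₆, show (432 : R) = 27 * 2 ^ 4 by norm_num, hε]; ring
  exact addVal_toNat_eq_of_eq hϖ isUnit_one
    (((isUnit_27 hε).mul (hεu.pow 4)).mul (hγ.pow 2)).neg e

/-- `ϖ ∣ Δ` for `y² = x³ + a₆` when `2 = ϖε`. [folklore] -/
theorem dvd_Δ_of_mordell {W : WeierstrassCurve R} (h₁ : W.a₁ = 0) (h₂ : W.a₂ = 0)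
    (h₃ : W.a₃ = 0) (h₄ : W.a₄ = 0) {ε : R} (hε : (2 : R) = uniformizer R * ε) :
    uniformizer R ∣ W.Δ := by
  rw [Δ_of_mordell h₁ h₂ h₃ h₄, show (432 : R) = 27 * 2 ^ 3 * 2 by norm_num, hε]
  exact ⟨-(27 * (uniformizer R * ε) ^ 3 * ε * W.a₆ ^ 2), by ring⟩

/-- `ϖⁿ ∥ ϖⁿβ` for a unit `β`. [folklore] -/
theorem not_pow_succ_dvd_pow_mul {β : R} (hβ : IsUnit β) (n : ℕ) :
    ¬ uniformizer R ^ (n + 1) ∣ uniformizer R ^ n * β := by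
  intro h
  rw [pow_succ, mul_dvd_mul_iff_left (pow_ne_zero n irreducible_uniformizer.ne_zero)] at h
  exact (isUnit_iff_not_dvd irreducible_uniformizer β).mp hβ h

/-- `1 + ϖx` is a unit. [folklore] -/
theorem isUnit_one_add_uniformizer_mul (x : R) : IsUnit (1 + uniformizer R * x) :=
  isUnit_add_mul_of_isUnit irreducible_uniformizer isUnit_one x

omit [IsDomain R] [IsDiscreteValuationRing R] in
/-- The `y`-translation `y ↦ y + t` of `y² = x³ + a₆`: coefficients `(0, 0, 2t, 0, a₆ - t²)`,
discriminant unchanged. [folklore] -/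
theorem mordell_yTranslate {W : WeierstrassCurve R} (h₁ : W.a₁ = 0) (h₂ : W.a₂ = 0)
    (h₃ : W.a₃ = 0) (h₄ : W.a₄ = 0) (t : R) :
    ((⟨1, 0, 0, t⟩ : WeierstrassCurve.VariableChange R) • W).a₁ = 0 ∧
      ((⟨1, 0, 0, t⟩ : WeierstrassCurve.VariableChange R) • W).a₂ = 0 ∧
      ((⟨1, 0, 0, t⟩ : WeierstrassCurve.VariableChange R) • W).a₃ = 2 * t ∧
      ((⟨1, 0, 0, t⟩ : WeierstrassCurve.VariableChange R) • W).a₄ = 0 ∧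
      ((⟨1, 0, 0, t⟩ : WeierstrassCurve.VariableChange R) • W).a₆ = W.a₆ - t ^ 2 ∧
      ((⟨1, 0, 0, t⟩ : WeierstrassCurve.VariableChange R) • W).Δ = W.Δ := by
  have hu : (⟨1, 0, 0, t⟩ : WeierstrassCurve.VariableChange R).u = 1 := rfl
  refine ⟨?_, ?_, ?_, ?_, ?_, Δ_smul_of_u_eq_one hu W⟩
  · rw [smul_a₁_of_u_eq_one hu, h₁]; simp
  · rw [smul_a₂_of_u_eq_one hu, h₁, h₂]; simp
  · rw [smul_a₃_of_u_eq_one hu, h₁, h₃]; simp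
  · rw [smul_a₄_of_u_eq_one hu, h₁, h₂, h₃, h₄]; simp
  · rw [smul_a₆_of_u_eq_one hu, h₁, h₂, h₃, h₄]; change W.a₆ + 0 * 0 + 0 ^ 2 * 0 + 0 ^ 3 - t * 0 - t ^ 2 - 0 * t * 0 = _; ring

variable [PerfectField (ResidueField R)]

/-- **`y² = x³ + γ` with `γ = 1 + ϖδ`, `δ` a unit: type `II`** (`2 = ϖε`; over `ℤ₂`: `k ≡ 3
(mod 4)`).  After `y ↦ y + 1` the model is `(0, 0, 2, 0, ϖδ)`, step-2 normalised with `π² ∤ a₆`.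
Silverman *ATAEC* IV.9.4, Steps 1–3. [cite: SilvermanATAEC1994, IV.9.4 Steps 1–3 and Table 4.1] -/
theorem kodairaSymbolOfMinimal_mordell_zero_eq_II {W : WeierstrassCurve R} (h₁ : W.a₁ = 0)
    (h₂ : W.a₂ = 0) (h₃ : W.a₃ = 0) (h₄ : W.a₄ = 0) {ε : R} (hε : (2 : R) = uniformizer R * ε)
    {δ : R} (ha₆ : W.a₆ = 1 + uniformizer R * δ) (hδ : IsUnit δ) :
    W.kodairaSymbolOfMinimal = .II := by
  obtain ⟨e1, e2, e3, e4, e6, eΔ⟩ := mordell_yTranslate h₁ h₂ h₃ h₄ (1 : R)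
  set V := (⟨1, 0, 0, 1⟩ : WeierstrassCurve.VariableChange R) • W with hV
  rw [mul_one, hε] at e3
  rw [ha₆, one_pow, add_sub_cancel_left] at e6
  rw [← WeierstrassCurve.kodairaSymbolOfMinimal_smul W ⟨1, 0, 0, 1⟩, ← hV]
  refine kodairaSymbolOfMinimal_eq_II_of_step2 ?_ ⟨ε, e3⟩ (by rw [e4]; exact dvd_zero _) ⟨δ, e6⟩ ?_ ?_
  · rw [eΔ]; exact dvd_Δ_of_mordell h₁ h₂ h₃ h₄ hε
  · rw [WeierstrassCurve.b₂, e1, e2]; simp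
  · rw [e6]; exact not_sq_dvd_uniformizer_mul hδ

/-- **`y² = x³ + γ` with `γ = 1 + ϖ²δ`: type `IV`** (`2 = ϖε`; over `ℤ₂`: `k ≡ 1 (mod 4)`).
After `y ↦ y + 1` the model is `(0, 0, 2, 0, ϖ²δ)`: `π² ∣ a₆`, `b₈ = 0`, `b₆ = 4γ`, `π³ ∤ b₆`.
Silverman *ATAEC* IV.9.4, Steps 1–5. [cite: SilvermanATAEC1994, IV.9.4 Steps 1–5 and Table 4.1] -/
theorem kodairaSymbolOfMinimal_mordell_zero_eq_IV {W : WeierstrassCurve R} (h₁ : W.a₁ = 0)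
    (h₂ : W.a₂ = 0) (h₃ : W.a₃ = 0) (h₄ : W.a₄ = 0) {ε : R} (hε : (2 : R) = uniformizer R * ε)
    (hεu : IsUnit ε) {δ : R} (ha₆ : W.a₆ = 1 + uniformizer R ^ 2 * δ) :
    W.kodairaSymbolOfMinimal = .IV := by
  have hϖ : Irreducible (uniformizer R) := irreducible_uniformizer
  obtain ⟨e1, e2, e3, e4, e6, eΔ⟩ := mordell_yTranslate h₁ h₂ h₃ h₄ (1 : R)
  set V := (⟨1, 0, 0, 1⟩ : WeierstrassCurve.VariableChange R) • W with hV
  rw [mul_one, hε] at e3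
  rw [ha₆, one_pow, add_sub_cancel_left] at e6
  rw [← WeierstrassCurve.kodairaSymbolOfMinimal_smul W ⟨1, 0, 0, 1⟩, ← hV]
  have hb₂ : uniformizer R ∣ V.b₂ := by rw [WeierstrassCurve.b₂, e1, e2]; simp
  refine kodairaSymbolOfMinimal_eq_IV_of_step2 ?_ ⟨ε, e3⟩ (by rw [e4]; exact dvd_zero _)
    ⟨uniformizer R * δ, by rw [e6]; ring⟩ hb₂ ⟨δ, e6⟩ ?_ ?_
  · rw [eΔ]; exact dvd_Δ_of_mordell h₁ h₂ h₃ h₄ hε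
  · rw [WeierstrassCurve.b₈, e1, e2, e3, e4, e6]; simp
  · rw [WeierstrassCurve.b₆, e3, e6, show (4 : R) = 2 * 2 by norm_num, hε]
    have e : (uniformizer R * ε) ^ 2 + uniformizer R * ε * (uniformizer R * ε) *
        (uniformizer R ^ 2 * δ) = uniformizer R ^ 2 * (ε ^ 2 * (1 + uniformizer R ^ 2 * δ)) := by
      ring
    rw [e]
    have hu : IsUnit (ε ^ 2 * (1 + uniformizer R ^ 2 * δ)) :=
      (hεu.pow 2).mul (by
        rw [pow_two, mul_assoc]; exact isUnit_one_add_uniformizer_mul _)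
    exact not_pow_succ_dvd_pow_mul hu 2

/-- **`y² = x³ + ϖγ`, `γ` a unit: type `II`** (`2 = ϖε`; over `ℤ₂`: `2 ∥ k`): the model itself is
step-2 normalised with `π² ∤ a₆`. Silverman *ATAEC* IV.9.4, Steps 1–3.
[cite: SilvermanATAEC1994, IV.9.4 Steps 1–3 and Table 4.1] -/
theorem kodairaSymbolOfMinimal_mordell_one_eq_II {W : WeierstrassCurve R} (h₁ : W.a₁ = 0)
    (h₂ : W.a₂ = 0) (h₃ : W.a₃ = 0) (h₄ : W.a₄ = 0) {ε : R} (hε : (2 : R) = uniformizer R * ε)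
    {γ : R} (ha₆ : W.a₆ = uniformizer R * γ) (hγ : IsUnit γ) :
    W.kodairaSymbolOfMinimal = .II := by
  refine kodairaSymbolOfMinimal_eq_II_of_step2 (dvd_Δ_of_mordell h₁ h₂ h₃ h₄ hε)
    (by rw [h₃]; exact dvd_zero _) (by rw [h₄]; exact dvd_zero _) ⟨γ, ha₆⟩ ?_ ?_
  · rw [WeierstrassCurve.b₂, h₁, h₂]; simp
  · rw [ha₆]; exact not_sq_dvd_uniformizer_mul hγ

/-- **`y² = x³ + ϖ²γ` with `γ = 1 + ϖδ`, `δ` a unit: type `I₀*`** (`2 = ϖε`; over `ℤ₂`: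
`k = 4u`, `u ≡ 3 (mod 4)`).  After `y ↦ y + ϖ` the model `(0, 0, 2ϖ, 0, ϖ³δ)` is step-6
normalised with cubic `T³ + δ̄`, of discriminant `-27δ̄² = δ̄² ≠ 0` in characteristic `2`.
Silverman *ATAEC* IV.9.4, Steps 1–6. [cite: SilvermanATAEC1994, IV.9.4 Steps 1–6 and Table 4.1] -/
theorem kodairaSymbolOfMinimal_mordell_two_eq_Istar_zero {W : WeierstrassCurve R} (h₁ : W.a₁ = 0)
    (h₂ : W.a₂ = 0) (h₃ : W.a₃ = 0) (h₄ : W.a₄ = 0) {ε : R} (hε : (2 : R) = uniformizer R * ε)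
    {δ : R} (ha₆ : W.a₆ = uniformizer R ^ 2 * (1 + uniformizer R * δ)) (hδ : IsUnit δ) :
    W.kodairaSymbolOfMinimal = .Istar 0 := by
  have hϖ : Irreducible (uniformizer R) := irreducible_uniformizer
  obtain ⟨e1, e2, e3, e4, e6, -⟩ := mordell_yTranslate h₁ h₂ h₃ h₄ (uniformizer R)
  set V := (⟨1, 0, 0, uniformizer R⟩ : WeierstrassCurve.VariableChange R) • W with hV
  rw [ha₆] at e6
  have e6' : V.a₆ = uniformizer R ^ 3 * δ := by rw [e6]; ring
  have e3' : V.a₃ = uniformizer R ^ 2 * ε := by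
    rw [e3, show (2 : R) * uniformizer R = uniformizer R * 2 by ring, hε]; ring
  rw [← WeierstrassCurve.kodairaSymbolOfMinimal_smul W ⟨1, 0, 0, uniformizer R⟩, ← hV]
  refine kodairaSymbolOfMinimal_eq_Istar_zero_of_step6 (by rw [e1]; exact dvd_zero _)
    (by rw [e2]; exact dvd_zero _) ⟨ε, e3'⟩ (by rw [e4]; exact dvd_zero _) ⟨δ, e6'⟩ ?_
  rw [cubicStep6, e2, e4, e6', redCoeff_uniformizer_pow_mul,
    redCoeff_eq_zero_of_dvd (j := 1) (dvd_zero _), redCoeff_eq_zero_of_dvd (j := 2) (dvd_zero _),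
    distinctRootCount_cubic_eq_three_iff]
  have h2 := residue_two_eq_zero hε
  have h27 : (27 : ResidueField R) = 1 := by
    rw [show (27 : ResidueField R) = 1 + 2 * 13 by norm_num, h2]; ring
  rw [h27]
  have hδ' : residue R δ ≠ 0 := (isUnit_iff_residue_ne_zero δ).mp hδ
  intro h
  apply hδ'
  have : residue R δ ^ 2 = 0 := by linear_combination -h
  exact pow_eq_zero_iff two_ne_zero |>.mp this

/-- **`y² = x³ + ϖ²γ` with `γ = 1 + ϖ²δ`: type `IV*`** (`2 = ϖε`; over `ℤ₂`: `k = 4u`,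
`u ≡ 1 (mod 4)`).  After `y ↦ y + ϖ` the model `(0, 0, 2ϖ, 0, ϖ⁴δ)` is step-8 normalised with
quadratic `Y² + ε̄Y - δ̄`, of discriminant `ε̄² ≠ 0` in characteristic `2`.
Silverman *ATAEC* IV.9.4, Steps 1–8. [cite: SilvermanATAEC1994, IV.9.4 Steps 1–8 and Table 4.1] -/
theorem kodairaSymbolOfMinimal_mordell_two_eq_IVstar {W : WeierstrassCurve R} (h₁ : W.a₁ = 0)
    (h₂ : W.a₂ = 0) (h₃ : W.a₃ = 0) (h₄ : W.a₄ = 0) {ε : R} (hε : (2 : R) = uniformizer R * ε)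
    (hεu : IsUnit ε) {δ : R} (ha₆ : W.a₆ = uniformizer R ^ 2 * (1 + uniformizer R ^ 2 * δ)) :
    W.kodairaSymbolOfMinimal = .IVstar := by
  obtain ⟨e1, e2, e3, e4, e6, -⟩ := mordell_yTranslate h₁ h₂ h₃ h₄ (uniformizer R)
  set V := (⟨1, 0, 0, uniformizer R⟩ : WeierstrassCurve.VariableChange R) • W with hV
  rw [ha₆] at e6
  have e6' : V.a₆ = uniformizer R ^ 4 * δ := by rw [e6]; ring
  have e3' : V.a₃ = uniformizer R ^ 2 * ε := by
    rw [e3, show (2 : R) * uniformizer R = uniformizer R * 2 by ring, hε]; ring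
  rw [← WeierstrassCurve.kodairaSymbolOfMinimal_smul W ⟨1, 0, 0, uniformizer R⟩, ← hV]
  refine kodairaSymbolOfMinimal_eq_IVstar_of_step8 (by rw [e1]; exact dvd_zero _)
    (by rw [e2]; exact dvd_zero _) ⟨ε, e3'⟩ (by rw [e4]; exact dvd_zero _) ⟨δ, e6'⟩ ?_
  rw [quadraticStep8, e3', e6', redCoeff_uniformizer_pow_mul, redCoeff_uniformizer_pow_mul,
    testA_iff_of_two_eq_zero (residue_two_eq_zero hε)]
  exact (isUnit_iff_residue_ne_zero ε).mp hεu

/-- **`y² = x³ + ϖ³γ`, `γ` a unit: type `I₀*`** (`2 = ϖε`; over `ℤ₂`: `8 ∥ k`): the model is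
step-6 normalised with cubic `T³ + γ̄`, three distinct roots in characteristic `2`.
Silverman *ATAEC* IV.9.4, Steps 1–6. [cite: SilvermanATAEC1994, IV.9.4 Steps 1–6 and Table 4.1] -/
theorem kodairaSymbolOfMinimal_mordell_three_eq_Istar_zero {W : WeierstrassCurve R}
    (h₁ : W.a₁ = 0) (h₂ : W.a₂ = 0) (h₃ : W.a₃ = 0) (h₄ : W.a₄ = 0) {ε : R}
    (hε : (2 : R) = uniformizer R * ε) {γ : R} (ha₆ : W.a₆ = uniformizer R ^ 3 * γ)
    (hγ : IsUnit γ) : W.kodairaSymbolOfMinimal = .Istar 0 := by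
  refine kodairaSymbolOfMinimal_eq_Istar_zero_of_step6 (by rw [h₁]; exact dvd_zero _)
    (by rw [h₂]; exact dvd_zero _) (by rw [h₃]; exact dvd_zero _) (by rw [h₄]; exact dvd_zero _)
    ⟨γ, ha₆⟩ ?_
  rw [cubicStep6, h₂, h₄, ha₆, redCoeff_uniformizer_pow_mul,
    redCoeff_eq_zero_of_dvd (j := 1) (dvd_zero _), redCoeff_eq_zero_of_dvd (j := 2) (dvd_zero _),
    distinctRootCount_cubic_eq_three_iff]
  have h2 := residue_two_eq_zero hε
  have h27 : (27 : ResidueField R) = 1 := by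
    rw [show (27 : ResidueField R) = 1 + 2 * 13 by norm_num, h2]; ring
  rw [h27]
  have hγ' : residue R γ ≠ 0 := (isUnit_iff_residue_ne_zero γ).mp hγ
  intro h
  apply hγ'
  have : residue R γ ^ 2 = 0 := by linear_combination -h
  exact pow_eq_zero_iff two_ne_zero |>.mp this

/-- **`y² = x³ + ϖ⁴γ` with `γ = 1 + ϖδ`, `δ` a unit: type `II*`** (`2 = ϖε`; over `ℤ₂`:
`k = 16u`, `u ≡ 3 (mod 4)`).  After `y ↦ y + ϖ²` the model `(0, 0, 2ϖ², 0, ϖ⁵δ)` is step-9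
normalised with `π⁴ ∣ a₄ = 0` and `π⁶ ∤ a₆`.  (For `u ≡ 1 (mod 4)` the equation is not minimal.)
Silverman *ATAEC* IV.9.4, Steps 1–10. [cite: SilvermanATAEC1994, IV.9.4 Steps 1–10 and Table 4.1] -/
theorem kodairaSymbolOfMinimal_mordell_four_eq_IIstar {W : WeierstrassCurve R} (h₁ : W.a₁ = 0)
    (h₂ : W.a₂ = 0) (h₃ : W.a₃ = 0) (h₄ : W.a₄ = 0) {ε : R} (hε : (2 : R) = uniformizer R * ε)
    {δ : R} (ha₆ : W.a₆ = uniformizer R ^ 4 * (1 + uniformizer R * δ)) (hδ : IsUnit δ) :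
    W.kodairaSymbolOfMinimal = .IIstar := by
  obtain ⟨e1, e2, e3, e4, e6, -⟩ := mordell_yTranslate h₁ h₂ h₃ h₄ (uniformizer R ^ 2)
  set V := (⟨1, 0, 0, uniformizer R ^ 2⟩ : WeierstrassCurve.VariableChange R) • W with hV
  rw [ha₆] at e6
  have e6' : V.a₆ = uniformizer R ^ 5 * δ := by rw [e6]; ring
  have e3' : V.a₃ = uniformizer R ^ 3 * ε := by
    rw [e3, show (2 : R) * uniformizer R ^ 2 = uniformizer R ^ 2 * 2 by ring, hε]; ring
  rw [← WeierstrassCurve.kodairaSymbolOfMinimal_smul W ⟨1, 0, 0, uniformizer R ^ 2⟩, ← hV]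
  refine kodairaSymbolOfMinimal_eq_IIstar_of_step9 (by rw [e1]; exact dvd_zero _)
    (by rw [e2]; exact dvd_zero _) ⟨ε, e3'⟩ (by rw [e4]; exact dvd_zero _) ⟨δ, e6'⟩ ?_
  rw [e6']; exact not_pow_succ_dvd_pow_mul hδ 5

/-- **`y² = x³ + ϖ⁵γ`, `γ` a unit: type `II*`** (`2 = ϖε`; over `ℤ₂`: `32 ∥ k`): the model itself
is step-9 normalised with `π⁶ ∤ a₆`. Silverman *ATAEC* IV.9.4, Steps 1–10.
[cite: SilvermanATAEC1994, IV.9.4 Steps 1–10 and Table 4.1] -/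
theorem kodairaSymbolOfMinimal_mordell_five_eq_IIstar {W : WeierstrassCurve R} (h₁ : W.a₁ = 0)
    (h₂ : W.a₂ = 0) (h₃ : W.a₃ = 0) (h₄ : W.a₄ = 0) {γ : R}
    (ha₆ : W.a₆ = uniformizer R ^ 5 * γ) (hγ : IsUnit γ) :
    W.kodairaSymbolOfMinimal = .IIstar := by
  refine kodairaSymbolOfMinimal_eq_IIstar_of_step9 (by rw [h₁]; exact dvd_zero _)
    (by rw [h₂]; exact dvd_zero _) (by rw [h₃]; exact dvd_zero _) (by rw [h₄]; exact dvd_zero _)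
    ⟨γ, ha₆⟩ ?_
  rw [ha₆]; exact not_pow_succ_dvd_pow_mul hγ 5

end Mordell

end TateAlgorithm

end Literature.NumberTheory.DiophantineGeometry

end
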